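import Summits.AtomisticToContinuum.BoseEinsteinCondensation.Theses.BECInfraredBound
import Summits.AtomisticToContinuum.BoseEinsteinCondensation.Theorems.BECGroundStateSOSIRModeCounting

/-!
# Negative lemmas for crux `BecWindowCount` (stmt-AtomisticToContinuum-9015): the window count at the
# PROFILE level — tightness of the `√ρ` rate, and the two load-bearing binder orders

Supports (does not close) stmt-AtomisticToContinuum-9015 (route `BECInfraredBound`, rank 9); landed copy of
§1–§3 of `Cruxes/BecWindowCount/Disproof.lean` (cdisprove seat, cycle 1); `sorry`-free, standard axioms; no
`Theses` decl is asserted (positively or at all) — every statement below is about the lattice PROFILE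
`C(1 + s/‖k‖∞)`, `s = √ρ·L_N`, on the window `0 < ‖k‖∞ ≤ K·s`, i.e. about the level at which every proof of the
crux operates (the candidate proofs in `Cruxes/BecWindowCount/` never unfold `occupation`).

* `boxSum_le_window_tsum` — reverse transfer: the punctured cube `{-M,…,M}³ ∖ 0`, `M ≤ R`, sits inside the
  window subtype `{k ≠ 0 ∧ ‖k‖∞ ≤ R}`, so its `Finset` sum is below the window `tsum` (`ℝ≥0∞`).
* `sum_inv_norm_latticeShell_ge` — `8M² ≤ Σ_{0<‖k‖∞≤M} 1/‖k‖∞` (each term `≥ 1/M`, `(2M+1)³ − 1 ≥ 8M³`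
  terms): the in-tree upper count `≤ 26M²` (`ModeCounting.sum_inv_norm_latticeShell_le_sq`) is sharp up to
  the constant.
* `windowProfile_tsum_ge` — TIGHTNESS: once `K√ρL ≥ 2`, the window sum of the profile is
  `≥ ofReal (2·C·K²·√ρ·N)`; the candidate proofs' rate `26C(K³+K²)√ρ` cannot be improved beyond the constant,
  so this glue forces `ρ₀(η) ≤ (η/(2CK²))²`.
* `BecWindowCountProfileWithoutUniformC`, `becWindowCountProfile_false_without_uniformC` — LOAD-BEARING:
  with the infrared constant allowed to depend on `ρ` (`∀ ρ ∃ C` instead of the crux's `∃ C ∀ ρ`) the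
  profile-level implication is FALSE (witness profile `ρ^{-1/2}(1 + s/‖k‖∞)`, which then carries `≥ 2N` in
  the window).
* `BecWindowCountProfileEtaUniform`, `becWindowCountProfile_false_etaUniform` — the natural strengthening
  "`ρ₀` independent of `η`" (`∃ ρ₀ ∀ η` instead of `∀ η ∃ ρ₀`) is FALSE at the profile level (witness: the
  profile itself, `η = √ρ`).

References: LSSY2005 Ch. 11, (11.26)–(11.27) (the infrared mode sum `c_d = (2π)^{-d}∫dp/E_p`, finite in
`d ≥ 3`, which the window sum discretises); DysonLiebSimon1978 §4.
-/

noncomputable section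

open Filter
open scoped ENNReal BigOperators

namespace Summit.AtomisticToContinuum.BoseEinsteinCondensation.Theorems.BecWindowCount.Negative

open Literature.MathematicalPhysics.QuantumManyBody.BoseGas
open Summit.AtomisticToContinuum.BoseEinsteinCondensation.Theorems.ModeCounting

/-- The cube `{-M, …, M}³ ⊂ ℤ³` as a `Finset` (local notation, as in `Theorems.ModeCounting`). -/
local notation "box[" M "]" =>
  (Fintype.piFinset fun _ : Fin 3 => Finset.Icc (-((M : ℕ) : ℤ)) ((M : ℕ) : ℤ) :
    Finset (Fin 3 → ℤ))

/-- The sup norm `‖k‖_∞` of `k ∈ ℤ³` (local notation, as in `Theorems.ModeCounting`). -/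
local notation "ν[" k "]" => ‖(fun i : Fin 3 => (((k : Fin 3 → ℤ) i : ℤ) : ℝ))‖

/-! ## §1 Reverse transfer and the lower lattice count -/

/-- A non-zero lattice point has sup norm `≥ 1`. [folklore] -/
theorem one_le_norm_of_ne_zero {k : Fin 3 → ℤ} (hk : k ≠ 0) : (1 : ℝ) ≤ ν[k] := by
  obtain ⟨j, hj⟩ := Function.ne_iff.1 hk
  have h1 : (1 : ℝ) ≤ |(k j : ℝ)| := by
    rw [← Int.cast_abs]
    exact_mod_cast Int.one_le_abs hj
  exact h1.trans (abs_apply_le_norm k j)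

/-- A point of the cube of radius `M` has sup norm `≤ M`. [folklore] -/
theorem norm_le_of_mem_latticeBox {M : ℕ} {k : Fin 3 → ℤ} (hk : k ∈ box[M]) : ν[k] ≤ M := by
  refine (pi_norm_le_iff_of_nonneg (Nat.cast_nonneg M)).2 fun j => ?_
  rw [Real.norm_eq_abs, ← Int.cast_abs]
  exact_mod_cast (mem_latticeBox.1 hk) j

/-- **Reverse transfer.** For `M ≤ R` the punctured cube `{-M,…,M}³ ∖ 0` lies inside the window
`{k ≠ 0 ∧ ‖k‖∞ ≤ R}`, so the `Finset` sum of any `ℝ≥0∞`-valued `f` over it is at most the window `tsum`.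
[folklore] -/
theorem boxSum_le_window_tsum {R : ℝ} {M : ℕ} (hM : (M : ℝ) ≤ R) (f : (Fin 3 → ℤ) → ℝ≥0∞) :
    ∑ k ∈ (box[M]).erase 0, f k
      ≤ ∑' k : {k : Fin 3 → ℤ // k ≠ 0 ∧ ‖(fun j => (k j : ℝ))‖ ≤ R}, f k.1 := by
  classical
  have hall : ∀ k ∈ (box[M]).erase 0, k ≠ 0 ∧ ‖(fun j => (k j : ℝ))‖ ≤ R := fun k hk =>
    ⟨(Finset.mem_erase.1 hk).1, (norm_le_of_mem_latticeBox (Finset.mem_erase.1 hk).2).trans hM⟩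
  calc ∑ k ∈ (box[M]).erase 0, f k
      = ∑ k ∈ ((box[M]).erase 0).filter (fun k => k ≠ 0 ∧ ‖(fun j => (k j : ℝ))‖ ≤ R), f k := by
        rw [Finset.filter_true_of_mem hall]
    _ = ∑ x ∈ ((box[M]).erase 0).subtype (fun k => k ≠ 0 ∧ ‖(fun j => (k j : ℝ))‖ ≤ R), f x.1 :=
        (Finset.sum_subtype_eq_sum_filter f).symm
    _ ≤ ∑' k : {k : Fin 3 → ℤ // k ≠ 0 ∧ ‖(fun j => (k j : ℝ))‖ ≤ R}, f k.1 :=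
        ENNReal.sum_le_tsum _

/-- **Lower harmonic shell count** `8M² ≤ Σ_{0 < ‖k‖∞ ≤ M} 1/‖k‖∞` on `ℤ³`: every term is `≥ 1/M` and there
are `(2M+1)³ − 1 ≥ 8M³` of them.  With `ModeCounting.sum_inv_norm_latticeShell_le_sq` (`≤ 26M²`) the
window harmonic sum is `Θ(M²)` — the `d = 3` signature the crux lives on. [folklore] -/
theorem sum_inv_norm_latticeShell_ge (M : ℕ) :
    8 * (M : ℝ) ^ 2 ≤ ∑ k ∈ (box[M]).erase 0, 1 / ν[k] := by
  classical
  rcases Nat.eq_zero_or_pos M with hM | hM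
  · subst hM
    simpa using Finset.sum_nonneg fun k _ => (by positivity : (0 : ℝ) ≤ 1 / ν[k])
  · have hM1 : (0 : ℝ) < M := by exact_mod_cast hM
    have hterm : ∀ k ∈ (box[M]).erase 0, 1 / (M : ℝ) ≤ 1 / ν[k] := by
      intro k hk
      have hk' := Finset.mem_erase.1 hk
      exact one_div_le_one_div_of_le (lt_of_lt_of_le one_pos (one_le_norm_of_ne_zero hk'.1))
        (norm_le_of_mem_latticeBox hk'.2)
    have hcard : ((((box[M]).erase 0).card : ℕ) : ℝ) = (2 * M + 1) ^ 3 - 1 := by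
      have h := Finset.card_erase_add_one (zero_mem_latticeBox M)
      rw [card_latticeBox] at h
      have h' : ((((box[M]).erase 0).card : ℕ) : ℝ) + 1 = (2 * M + 1) ^ 3 := by exact_mod_cast h
      linarith
    calc 8 * (M : ℝ) ^ 2 ≤ ((2 * (M : ℝ) + 1) ^ 3 - 1) * (1 / (M : ℝ)) := by
          rw [mul_one_div, le_div_iff₀ hM1]
          nlinarith [sq_nonneg (M : ℝ)]
      _ = ∑ _k ∈ (box[M]).erase 0, 1 / (M : ℝ) := by
          rw [Finset.sum_const, nsmul_eq_mul, hcard]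
      _ ≤ ∑ k ∈ (box[M]).erase 0, 1 / ν[k] := Finset.sum_le_sum hterm

/-! ## §2 Tightness of the `√ρ` rate -/

/-- The exact scale identity `(√ρ · L_N)³ = √ρ · N`, `L_N = (N/ρ)^{1/3}`. [folklore] -/
theorem sqrt_mul_sideLength_pow_three {ρ : ℝ} (hρ : 0 < ρ) (N : ℕ) :
    (Real.sqrt ρ * sideLength ρ N) ^ 3 = Real.sqrt ρ * N := by
  rw [mul_pow, sideLength_pow_three hρ N]
  have hs : Real.sqrt ρ ^ 3 = ρ * Real.sqrt ρ := by
    rw [pow_succ, Real.sq_sqrt hρ.le]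
  rw [hs]
  field_simp

/-- `√ρ · L_N ≥ 2` eventually in `N` (indeed as soon as `√ρ · N ≥ 8`). [folklore] -/
theorem eventually_two_le_sqrt_mul_sideLength {ρ : ℝ} (hρ : 0 < ρ) :
    ∀ᶠ N : ℕ in atTop, 2 ≤ Real.sqrt ρ * sideLength ρ N := by
  have hsq : 0 < Real.sqrt ρ := Real.sqrt_pos.2 hρ
  filter_upwards [eventually_ge_atTop ⌈8 / Real.sqrt ρ⌉₊] with N hN
  have hs : 0 ≤ Real.sqrt ρ * sideLength ρ N := mul_nonneg hsq.le (sideLength_nonneg hρ.le N)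
  have hN' : 8 / Real.sqrt ρ ≤ N := (Nat.le_ceil _).trans (by exact_mod_cast hN)
  have h8 : (8 : ℝ) ≤ Real.sqrt ρ * N := by
    rw [div_le_iff₀ hsq] at hN'
    linarith
  by_contra hlt
  push Not at hlt
  have h3 : (Real.sqrt ρ * sideLength ρ N) ^ 3 < 2 ^ 3 := pow_lt_pow_left₀ hlt hs three_ne_zero
  rw [sqrt_mul_sideLength_pow_three hρ N] at h3
  linarith

/-- **Tightness of the window count.** For every profile constant `C ≥ 0`, `K ≥ 0`, `ρ > 0` and every `N`
with `K√ρL_N ≥ 2`, the window sum of the infrared profile `ofReal (C(1 + √ρL/‖k‖∞))` is at least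
`ofReal (2·C·K²·√ρ·N)`.  Against the candidate proofs' upper bound `ofReal (26C(K³+K²)√ρ·N)`: the rate `√ρ`
(relative depletion of Bogoliubov/LHY order in the route's units) is EXACT at the profile level, so the glue
can certify a window fraction `η` only for `ρ ≤ (η/(2CK²))²`. [folklore] -/
theorem windowProfile_tsum_ge {C K ρ : ℝ} (hC : 0 ≤ C) (hK : 0 ≤ K) (hρ : 0 < ρ) (N : ℕ)
    (hR : 2 ≤ K * Real.sqrt ρ * sideLength ρ N) :
    ENNReal.ofReal (2 * C * K ^ 2 * Real.sqrt ρ * N) ≤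
      ∑' k : {k : Fin 3 → ℤ // k ≠ 0 ∧ ‖(fun j => (k j : ℝ))‖ ≤ K * Real.sqrt ρ * sideLength ρ N},
        ENNReal.ofReal (C * (1 + Real.sqrt ρ * sideLength ρ N / ‖(fun j => (k.1 j : ℝ))‖)) := by
  classical
  set s : ℝ := Real.sqrt ρ * sideLength ρ N with hsdef
  have hs : 0 ≤ s := mul_nonneg (Real.sqrt_nonneg ρ) (sideLength_nonneg hρ.le N)
  have hKs : K * Real.sqrt ρ * sideLength ρ N = K * s := by rw [hsdef]; ring
  rw [hKs] at hR ⊢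
  set M : ℕ := ⌊K * s⌋₊ with hMdef
  have hMR : (M : ℝ) ≤ K * s := Nat.floor_le (mul_nonneg hK hs)
  have hRM : K * s ≤ 2 * (M : ℝ) := by
    have h1 : K * s < (M : ℝ) + 1 := Nat.lt_floor_add_one (K * s)
    linarith
  have hcube : s ^ 3 = Real.sqrt ρ * N := sqrt_mul_sideLength_pow_three hρ N
  have hterm : ∀ k ∈ (box[M]).erase 0, C * s * (1 / ν[k]) ≤ C * (1 + s / ν[k]) := by
    intro k _
    have h : C * (1 + s / ν[k]) = C * s * (1 / ν[k]) + C := by ring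
    rw [h]
    linarith
  calc ENNReal.ofReal (2 * C * K ^ 2 * Real.sqrt ρ * N)
      = ENNReal.ofReal (2 * C * s * (K * s) ^ 2) := by
        congr 1
        calc 2 * C * K ^ 2 * Real.sqrt ρ * N = 2 * C * K ^ 2 * s ^ 3 := by rw [hcube]; ring
          _ = 2 * C * s * (K * s) ^ 2 := by ring
    _ ≤ ENNReal.ofReal (C * s * (8 * (M : ℝ) ^ 2)) := by
        refine ENNReal.ofReal_le_ofReal ?_
        have hsq : (K * s) ^ 2 ≤ (2 * (M : ℝ)) ^ 2 :=
          pow_le_pow_left₀ (mul_nonneg hK hs) hRM 2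
        nlinarith [mul_le_mul_of_nonneg_left hsq (mul_nonneg hC hs)]
    _ ≤ ENNReal.ofReal (∑ k ∈ (box[M]).erase 0, C * (1 + s / ν[k])) := by
        refine ENNReal.ofReal_le_ofReal ?_
        calc C * s * (8 * (M : ℝ) ^ 2) ≤ C * s * ∑ k ∈ (box[M]).erase 0, 1 / ν[k] :=
              mul_le_mul_of_nonneg_left (sum_inv_norm_latticeShell_ge M) (mul_nonneg hC hs)
          _ = ∑ k ∈ (box[M]).erase 0, C * s * (1 / ν[k]) := Finset.mul_sum _ _ _
          _ ≤ ∑ k ∈ (box[M]).erase 0, C * (1 + s / ν[k]) := Finset.sum_le_sum hterm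
    _ = ∑ k ∈ (box[M]).erase 0, ENNReal.ofReal (C * (1 + s / ν[k])) :=
        ENNReal.ofReal_sum_of_nonneg fun k _ => by positivity
    _ ≤ ∑' k : {k : Fin 3 → ℤ // k ≠ 0 ∧ ‖(fun j => (k j : ℝ))‖ ≤ K * s},
          ENNReal.ofReal (C * (1 + s / ‖(fun j => (k.1 j : ℝ))‖)) :=
        boxSum_le_window_tsum hMR fun k => ENNReal.ofReal (C * (1 + s / ν[k]))

/-! ## §3 The two load-bearing binder orders, at the profile level

The crux `BecWindowCount` is an implication about the occupations `⟨φ'_k, γ_Ψ φ'_k⟩` of δ-near-minimisers; its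
proofs (`Cruxes/BecWindowCount/CandidateProofIntegerRadius.lean`, `…/IdeaSketchInTreeCountsHomogeneous.lean`)
never look inside `occupation`, `energy`, `TrialState` or `IsRepulsiveFiniteRange`: they prove the implication
for an ARBITRARY occupation family.  At that level two binder orders are load-bearing — the infrared constant
must be uniform in `ρ`, and the density threshold must be allowed to depend on `η`.  (The literal physics
statements with these binders swapped are NOT decided here: that would need the true momentum distribution of
Dirichlet near-minimisers, i.e. the open crux `BecIrWindow` and more.) -/

/-- PROFILE form of the crux with the infrared constant allowed to depend on the density: the occupation
functional is an arbitrary family `n ρ N k : ℝ≥0∞` (in the crux, `occupation N φ'_k Ψ.ψ`; the decorations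
`v, ε, δ, Ψ` are suppressed), the hypothesis has `∀ ρ ∃ C` where the crux has `∃ C ∀ ρ`, the conclusion is the
crux's. -/
def BecWindowCountProfileWithoutUniformC : Prop :=
  ∀ n : ℝ → ℕ → (Fin 3 → ℤ) → ℝ≥0∞,
    (∀ K : ℝ, 0 < K → ∃ ρ₀ : ℝ, 0 < ρ₀ ∧ ∀ ρ : ℝ, 0 < ρ → ρ < ρ₀ → ∃ C : ℝ, 0 < C ∧
      ∀ᶠ N : ℕ in atTop, ∀ k : Fin 3 → ℤ, k ≠ 0 →
        ‖(fun j => (k j : ℝ))‖ ≤ K * Real.sqrt ρ * sideLength ρ N →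
          n ρ N k ≤ ENNReal.ofReal (C * (1 + Real.sqrt ρ * sideLength ρ N / ‖(fun j => (k j : ℝ))‖))) →
    ∀ K : ℝ, 0 < K → ∀ η : ℝ, 0 < η → ∃ ρ₀ : ℝ, 0 < ρ₀ ∧ ∀ ρ : ℝ, 0 < ρ → ρ < ρ₀ →
      ∀ᶠ N : ℕ in atTop,
        ∑' k : {k : Fin 3 → ℤ // k ≠ 0 ∧ ‖(fun j => (k j : ℝ))‖ ≤ K * Real.sqrt ρ * sideLength ρ N},
          n ρ N k.1 ≤ ENNReal.ofReal (η * N)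

/-- **`ρ`-uniformity of the infrared constant is load-bearing** (profile level): with `∀ ρ ∃ C` the window
count fails — the profile `n ρ N k = ofReal (ρ^{-1/2}(1 + √ρL/‖k‖∞))` obeys the window bound with
`C(ρ) = ρ^{-1/2}` but carries at least `2N > 1·N` in the window `K = 1` for all large `N`
(`windowProfile_tsum_ge`).  Any proof of `BecWindowCount` that is parametric in the occupation functional —
as both candidate proofs are — must therefore use the binder order `∃ C ∀ ρ < ρ₀` of `BecIrWindow`. [folklore] -/
theorem becWindowCountProfile_false_without_uniformC : ¬ BecWindowCountProfileWithoutUniformC := by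
  intro h
  set n : ℝ → ℕ → (Fin 3 → ℤ) → ℝ≥0∞ := fun ρ N k =>
    ENNReal.ofReal ((Real.sqrt ρ)⁻¹ * (1 + Real.sqrt ρ * sideLength ρ N / ‖(fun j => (k j : ℝ))‖))
    with hn
  have hyp : ∀ K : ℝ, 0 < K → ∃ ρ₀ : ℝ, 0 < ρ₀ ∧ ∀ ρ : ℝ, 0 < ρ → ρ < ρ₀ → ∃ C : ℝ, 0 < C ∧
      ∀ᶠ N : ℕ in atTop, ∀ k : Fin 3 → ℤ, k ≠ 0 →
        ‖(fun j => (k j : ℝ))‖ ≤ K * Real.sqrt ρ * sideLength ρ N →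
          n ρ N k ≤ ENNReal.ofReal (C * (1 + Real.sqrt ρ * sideLength ρ N / ‖(fun j => (k j : ℝ))‖)) :=
    fun K _ => ⟨1, one_pos, fun ρ hρ _ => ⟨(Real.sqrt ρ)⁻¹, inv_pos.2 (Real.sqrt_pos.2 hρ),
      Eventually.of_forall fun N k _ _ => le_rfl⟩⟩
  obtain ⟨ρ₀, hρ₀, H⟩ := h n hyp 1 one_pos 1 one_pos
  have hρ : (0 : ℝ) < ρ₀ / 2 := by positivity
  have hsq : 0 < Real.sqrt (ρ₀ / 2) := Real.sqrt_pos.2 hρ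
  have hev := (H (ρ₀ / 2) hρ (by linarith)).and
    ((eventually_two_le_sqrt_mul_sideLength hρ).and (eventually_ge_atTop 1))
  obtain ⟨N, hN1, hN2, hN3⟩ := hev.exists
  have hlow := windowProfile_tsum_ge (C := (Real.sqrt (ρ₀ / 2))⁻¹) (K := 1) (inv_pos.2 hsq).le
    zero_le_one hρ N (by simpa using hN2)
  have hle : ENNReal.ofReal (2 * (Real.sqrt (ρ₀ / 2))⁻¹ * 1 ^ 2 * Real.sqrt (ρ₀ / 2) * N) ≤
      ENNReal.ofReal (1 * N) := hlow.trans hN1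
  rw [ENNReal.ofReal_le_ofReal_iff (by positivity)] at hle
  have h2 : 2 * (Real.sqrt (ρ₀ / 2))⁻¹ * 1 ^ 2 * Real.sqrt (ρ₀ / 2) * N = 2 * N := by
    field_simp
  rw [h2] at hle
  have hN3' : (1 : ℝ) ≤ N := by exact_mod_cast hN3
  linarith

/-- PROFILE form of the natural strengthening "`ρ₀` independent of `η`": hypothesis exactly the crux's
(infrared constant uniform in `ρ`), conclusion with `∃ ρ₀ ∀ η` where the crux has `∀ η ∃ ρ₀`. -/
def BecWindowCountProfileEtaUniform : Prop :=
  ∀ n : ℝ → ℕ → (Fin 3 → ℤ) → ℝ≥0∞,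
    (∀ K : ℝ, 0 < K → ∃ ρ₀ : ℝ, 0 < ρ₀ ∧ ∃ C : ℝ, 0 < C ∧ ∀ ρ : ℝ, 0 < ρ → ρ < ρ₀ →
      ∀ᶠ N : ℕ in atTop, ∀ k : Fin 3 → ℤ, k ≠ 0 →
        ‖(fun j => (k j : ℝ))‖ ≤ K * Real.sqrt ρ * sideLength ρ N →
          n ρ N k ≤ ENNReal.ofReal (C * (1 + Real.sqrt ρ * sideLength ρ N / ‖(fun j => (k j : ℝ))‖))) →
    ∀ K : ℝ, 0 < K → ∃ ρ₀ : ℝ, 0 < ρ₀ ∧ ∀ η : ℝ, 0 < η → ∀ ρ : ℝ, 0 < ρ → ρ < ρ₀ →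
      ∀ᶠ N : ℕ in atTop,
        ∑' k : {k : Fin 3 → ℤ // k ≠ 0 ∧ ‖(fun j => (k j : ℝ))‖ ≤ K * Real.sqrt ρ * sideLength ρ N},
          n ρ N k.1 ≤ ENNReal.ofReal (η * N)

/-- **`ρ₀` must depend on `η`** (profile level): the strengthening `∃ ρ₀ ∀ η` is false — the profile itself
(`C = 1`) obeys the crux's hypothesis and carries `≥ 2√ρ·N` in the window `K = 1`, which beats `η·N` at
`η = √ρ` for every `ρ`.  So the window-count glue can only deliver "arbitrarily small window fraction" by
sending `ρ₀ → 0` with `η` (`ρ₀ ≲ (η/(2CK²))²`), never uniformly. [folklore] -/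
theorem becWindowCountProfile_false_etaUniform : ¬ BecWindowCountProfileEtaUniform := by
  intro h
  set n : ℝ → ℕ → (Fin 3 → ℤ) → ℝ≥0∞ := fun ρ N k =>
    ENNReal.ofReal (1 * (1 + Real.sqrt ρ * sideLength ρ N / ‖(fun j => (k j : ℝ))‖)) with hn
  have hyp : ∀ K : ℝ, 0 < K → ∃ ρ₀ : ℝ, 0 < ρ₀ ∧ ∃ C : ℝ, 0 < C ∧ ∀ ρ : ℝ, 0 < ρ → ρ < ρ₀ →
      ∀ᶠ N : ℕ in atTop, ∀ k : Fin 3 → ℤ, k ≠ 0 →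
        ‖(fun j => (k j : ℝ))‖ ≤ K * Real.sqrt ρ * sideLength ρ N →
          n ρ N k ≤ ENNReal.ofReal (C * (1 + Real.sqrt ρ * sideLength ρ N / ‖(fun j => (k j : ℝ))‖)) :=
    fun K _ => ⟨1, one_pos, 1, one_pos, fun ρ _ _ => Eventually.of_forall fun N k _ _ => le_rfl⟩
  obtain ⟨ρ₀, hρ₀, H⟩ := h n hyp 1 one_pos
  have hρ : (0 : ℝ) < ρ₀ / 2 := by positivity
  have hsq : 0 < Real.sqrt (ρ₀ / 2) := Real.sqrt_pos.2 hρ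
  have hev := (H (Real.sqrt (ρ₀ / 2)) hsq (ρ₀ / 2) hρ (by linarith)).and
    ((eventually_two_le_sqrt_mul_sideLength hρ).and (eventually_ge_atTop 1))
  obtain ⟨N, hN1, hN2, hN3⟩ := hev.exists
  have hlow := windowProfile_tsum_ge (C := 1) (K := 1) zero_le_one zero_le_one hρ N (by simpa using hN2)
  have hle : ENNReal.ofReal (2 * 1 * 1 ^ 2 * Real.sqrt (ρ₀ / 2) * N) ≤
      ENNReal.ofReal (Real.sqrt (ρ₀ / 2) * N) := hlow.trans hN1
  rw [ENNReal.ofReal_le_ofReal_iff (by positivity)] at hle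
  have hN3' : (1 : ℝ) ≤ N := by exact_mod_cast hN3
  nlinarith [mul_pos hsq (lt_of_lt_of_le one_pos hN3')]

end Summit.AtomisticToContinuum.BoseEinsteinCondensation.Theorems.BecWindowCount.Negative

end
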